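import Mathlib.LinearAlgebra.CrossProduct
import HarnessLib

/-!
# K2R `RealisedQuasiStaticCellLaw`, line `floquet-bloch`: orthonormal frames from the cross product (the in-plane
# polarisation frame of a principal ladder) — helper towards `stub_lowSectorDecay` / `stub_upperSome`
# (`--supports stmt-AnomalousDissipation-20446`)

Summits-side helper file (everything proved; no definitions, no named facts; pure linear algebra over a commutative ring,
so that it applies verbatim to complexified real frames). For `e₁, e₃ : Fin 3 → R` with `e₁·e₁ = e₃·e₃ = 1`, `e₃·e₁ = 0`
and `e₂ := e₃ × e₁`: the frame relations `e₁ × e₂ = e₃`, `e₃ × e₂ = -e₁`, `e₂·e₂ = 1`, `e₂·e₁ = e₂·e₃ = 0`, and the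
**expansion of every vector transversal to `e₃`**: `x·e₃ = 0 ⟹ x = (e₁·x) e₁ + (e₂·x) e₂` (`frame_expansion`; vector triple
products only). In the Bloch-sector analysis of the crux (STUB-PLAN `stub_lowSectorDecay` §1) `e₃ = k̂_J` is the direction
of a ladder frequency, `e₁ = ζ` the normal of the plane `span(k₀, K_j)` (out-of-plane polarisation) and `e₂ = p_J` the
in-plane polarisation; the expansion is what makes the in-plane components a closed three-term ladder with the Leray
cosines `p_J·p_{J±1}` as links.
-/

set_option linter.dupNamespace false

namespace Summit.AnomalousDissipation.AnomalousDissipation.Theorems.SolenoidalFractalHomogenisation.RealisedQuasiStaticCellLaw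

open Matrix
open scoped Matrix

variable {R : Type*} [CommRing R]

/-- Frame relation: `e₁ × (e₃ × e₁) = e₃`. -/
theorem frame_e1_cross_e2 (e1 e3 : Fin 3 → R) (h11 : e1 ⬝ᵥ e1 = 1) (h31 : e3 ⬝ᵥ e1 = 0) :
    e1 ⨯₃ (e3 ⨯₃ e1) = e3 := by
  rw [cross_cross_eq_smul_sub_smul', h11, h31, one_smul, zero_smul, sub_zero]

/-- Frame relation: `e₃ × (e₃ × e₁) = -e₁`. -/
theorem frame_e3_cross_e2 (e1 e3 : Fin 3 → R) (h33 : e3 ⬝ᵥ e3 = 1) (h31 : e3 ⬝ᵥ e1 = 0) :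
    e3 ⨯₃ (e3 ⨯₃ e1) = -e1 := by
  rw [cross_cross_eq_smul_sub_smul', h31, h33, zero_smul, one_smul, zero_sub]

/-- Frame relation: `e₂·e₂ = 1` for `e₂ = e₃ × e₁`. -/
theorem frame_e2_dot_e2 (e1 e3 : Fin 3 → R) (h11 : e1 ⬝ᵥ e1 = 1) (h33 : e3 ⬝ᵥ e3 = 1) (h31 : e3 ⬝ᵥ e1 = 0) :
    (e3 ⨯₃ e1) ⬝ᵥ (e3 ⨯₃ e1) = 1 := by
  rw [cross_dot_cross, h33, h11, h31]; ring

/-- Frame relation: `e₂·e₁ = 0`. -/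
theorem frame_e2_dot_e1 (e1 e3 : Fin 3 → R) : (e3 ⨯₃ e1) ⬝ᵥ e1 = 0 := by
  rw [dotProduct_comm]; exact dot_cross_self e3 e1

/-- Frame relation: `e₂·e₃ = 0`. -/
theorem frame_e2_dot_e3 (e1 e3 : Fin 3 → R) : (e3 ⨯₃ e1) ⬝ᵥ e3 = 0 := by
  rw [dotProduct_comm]; exact dot_self_cross e3 e1

/-- **Expansion in the frame**: every `x` transversal to `e₃` is `(e₁·x) e₁ + (e₂·x) e₂`, `e₂ = e₃ × e₁`. -/
theorem frame_expansion (e1 e3 x : Fin 3 → R) (h11 : e1 ⬝ᵥ e1 = 1) (h33 : e3 ⬝ᵥ e3 = 1) (h31 : e3 ⬝ᵥ e1 = 0)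
    (hx : x ⬝ᵥ e3 = 0) :
    x = (e1 ⬝ᵥ x) • e1 + ((e3 ⨯₃ e1) ⬝ᵥ x) • (e3 ⨯₃ e1) := by
  -- `x = e₃ × (x × e₃)`
  have h1 : e3 ⨯₃ (x ⨯₃ e3) = x := by
    rw [cross_cross_eq_smul_sub_smul', h33, hx, one_smul, zero_smul, sub_zero]
  -- `x × e₃ = x × (e₁ × e₂) = (x·e₂) e₁ - (e₁·x) e₂`
  have h2 : x ⨯₃ e3 = (x ⬝ᵥ (e3 ⨯₃ e1)) • e1 - (e1 ⬝ᵥ x) • (e3 ⨯₃ e1) := by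
    conv_lhs => rw [← frame_e1_cross_e2 e1 e3 h11 h31]
    rw [cross_cross_eq_smul_sub_smul']
  -- `e₃ × (that) = (x·e₂) e₂ + (e₁·x) e₁`
  have h3 : e3 ⨯₃ ((x ⬝ᵥ (e3 ⨯₃ e1)) • e1 - (e1 ⬝ᵥ x) • (e3 ⨯₃ e1)) =
      (x ⬝ᵥ (e3 ⨯₃ e1)) • (e3 ⨯₃ e1) + (e1 ⬝ᵥ x) • e1 := by
    rw [map_sub, map_smul, map_smul, frame_e3_cross_e2 e1 e3 h33 h31, smul_neg, sub_neg_eq_add]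
  calc x = e3 ⨯₃ (x ⨯₃ e3) := h1.symm
    _ = (x ⬝ᵥ (e3 ⨯₃ e1)) • (e3 ⨯₃ e1) + (e1 ⬝ᵥ x) • e1 := by rw [h2, h3]
    _ = (e1 ⬝ᵥ x) • e1 + ((e3 ⨯₃ e1) ⬝ᵥ x) • (e3 ⨯₃ e1) := by rw [add_comm, dotProduct_comm x]

/-- **Pairing a transversal vector with the next in-plane direction**: if `x·e₃ = 0` and `q·e₁ = 0` then
`q·x = (q·e₂)(e₂·x)`, `e₂ = e₃ × e₁` (only the in-plane component of `x` is seen by an in-plane `q`). -/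
theorem frame_dot_of_transversal (e1 e3 x q : Fin 3 → R) (h11 : e1 ⬝ᵥ e1 = 1) (h33 : e3 ⬝ᵥ e3 = 1)
    (h31 : e3 ⬝ᵥ e1 = 0) (hx : x ⬝ᵥ e3 = 0) (hq : q ⬝ᵥ e1 = 0) :
    q ⬝ᵥ x = (q ⬝ᵥ (e3 ⨯₃ e1)) * ((e3 ⨯₃ e1) ⬝ᵥ x) := by
  conv_lhs => rw [frame_expansion e1 e3 x h11 h33 h31 hx]
  rw [dotProduct_add, dotProduct_smul, dotProduct_smul, hq, smul_eq_mul, smul_eq_mul, mul_zero, zero_add, mul_comm]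

end Summit.AnomalousDissipation.AnomalousDissipation.Theorems.SolenoidalFractalHomogenisation.RealisedQuasiStaticCellLaw
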